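import Summits.KontsevichZagierPeriods.KontsevichZagierPeriods.Theorems.BetaCancellation.Negative.PiLink
import Literature.NumberTheory.Transcendental.KZLogCalculusProofs

/-!
# `BetaCancellation` (stmt-KontsevichZagierPeriods-13633) — line `dirichlet-companion-to-pi`,
stub `stub_piAsArctan`

`π` as an arctangent integral inside the Kontsevich–Zagier calculus:
`[(-1,1), 2 dt/(1+t²)] ∼ [{x²+y² ≤ 1}, 1]`. The new move is ONE change of variables (rule (2),
`KZ.changeOfVariablesRel`): the rational map `Φ(t) = 2t/(1+t²)` is a bijection of `(-1,1)` onto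
itself (injective since `Φ t = Φ u` forces `(t−u)(1−tu) = 0` with `|tu| < 1`; onto since
`y = Φ(y/(1+√(1−y²)))`), with `Φ'(t) = 2(1−t²)/(1+t²)² > 0` and `√(1−Φ(t)²) = (1−t²)/(1+t²)`, so
`(1/√(1−x²))∘Φ · |Φ'| = 2/(1+t²)`: this is `[(-1,1), 2/(1+t²)] ∼ [(-1,1), 1/√(1−x²)]`
(`= invSqrtRep` of `Negative/PiLinkReps.lean`). The rest of the chain is Kontsevich–Zagier's §1.1
example, already inside the calculus (`Negative/PiLinkMoves.lean`, `Negative/PiLink.lean`):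
`invSqrtRep ∼ twoSqrtRep ∼ piRep`, and a representation with the disc as domain and integrand `1` on
it differs from `piRep` by a relation (`KZ.of_sub_of_mem_relations_of_eqOn`). No definitions are
introduced (the substitution and its derivative are written out), so the file is a pure proof file.

References: M. Kontsevich, D. Zagier, *Periods* (2001), §1.1 (eq. (1) and the `√(1−x²)` example),
§1.2 rule (2).
-/

noncomputable section

-- `Summit.KontsevichZagierPeriods.KontsevichZagierPeriods.…` is the tree's mandated layout (single-conjunct summit).
set_option linter.dupNamespace false

namespace Summit.KontsevichZagierPeriods.KontsevichZagierPeriods.BetaCancellationLine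

open MeasureTheory Set Real
open Literature.NumberTheory.Transcendental
open Literature.NumberTheory.Transcendental.KZ
open Literature.ModelTheory.ExponentialFields (IsSemialgebraic)
open MvPolynomial (aeval X C)
open Summit.KontsevichZagierPeriods.KontsevichZagierPeriods.BetaCancellationNegative
  (symIoo mem_symIoo invSqrtRep invSqrtRep_domain invSqrtRep_integrand_eq
    equivalent_invSqrtRep_twoSqrtRep equivalent_twoSqrtRep_piRep)

/-! ## The substitution `x = 2t/(1+t²)` on `(-1,1)` -/

/-- `t u < 1` for `t, u ∈ (-1,1)`. [folklore] -/
theorem piArc_mul_lt_one {t u : ℝ} (ht : t ∈ Ioo (-1:ℝ) 1) (hu : u ∈ Ioo (-1:ℝ) 1) : t * u < 1 := by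
  nlinarith [mul_pos (sub_pos.2 ht.2) (show (0:ℝ) < 1 + u by linarith [hu.1]),
    mul_pos (show (0:ℝ) < 1 + t by linarith [ht.1]) (sub_pos.2 hu.2)]

/-- `Φ(t) = 2t/(1+t²)` maps `(-1,1)` into `(-1,1)`. [folklore] -/
theorem piArc_mapsTo {t : ℝ} (ht : t ∈ Ioo (-1:ℝ) 1) : 2 * t / (1 + t ^ 2) ∈ Ioo (-1:ℝ) 1 := by
  have hpos : (0:ℝ) < 1 + t ^ 2 := by positivity
  have h1 : (0:ℝ) < (1 - t) * (1 - t) := mul_pos (sub_pos.2 ht.2) (sub_pos.2 ht.2)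
  have h2 : (0:ℝ) < (1 + t) * (1 + t) :=
    mul_pos (by linarith [ht.1]) (by linarith [ht.1])
  constructor
  · rw [lt_div_iff₀ hpos]
    nlinarith
  · rw [div_lt_one hpos]
    nlinarith

/-- `Φ` is injective on `(-1,1)`: `Φ t = Φ u` gives `(t − u)(1 − tu) = 0`. [folklore] -/
theorem piArc_injOn :
    InjOn (fun y : Fin 1 → ℝ => (fun _ : Fin 1 => 2 * y 0 / (1 + y 0 ^ 2)))
      {x : Fin 1 → ℝ | x 0 ∈ Set.Ioo (-1:ℝ) 1} := by
  intro x hx y hy hxy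
  have e := congrFun hxy 0
  simp only at e
  have hx' : (0:ℝ) < 1 + x 0 ^ 2 := by positivity
  have hy' : (0:ℝ) < 1 + y 0 ^ 2 := by positivity
  rw [div_eq_div_iff hx'.ne' hy'.ne'] at e
  have h1 : (x 0 - y 0) * (1 - x 0 * y 0) = 0 := by linear_combination e / 2
  have hlt : x 0 * y 0 < 1 := piArc_mul_lt_one hx hy
  rcases mul_eq_zero.1 h1 with h | h
  · funext i
    obtain rfl : i = 0 := Fin.fin_one_eq_zero i
    exact sub_eq_zero.1 h
  · exact absurd (sub_eq_zero.1 h).symm hlt.ne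

/-- `Φ` maps `(-1,1)` ONTO `(-1,1)`: `y = Φ (y / (1 + √(1 − y²)))`. [folklore] -/
theorem piArc_image :
    (fun y : Fin 1 → ℝ => (fun _ : Fin 1 => 2 * y 0 / (1 + y 0 ^ 2))) ''
        {x : Fin 1 → ℝ | x 0 ∈ Set.Ioo (-1:ℝ) 1} = {x : Fin 1 → ℝ | x 0 ∈ Set.Ioo (-1:ℝ) 1} := by
  ext y
  constructor
  · rintro ⟨x, hx, rfl⟩
    exact piArc_mapsTo hx
  · intro hy
    have hy' : y 0 ∈ Ioo (-1:ℝ) 1 := hy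
    set w : ℝ := √(1 - y 0 ^ 2) with hw
    have hu : (0:ℝ) ≤ 1 - y 0 ^ 2 := by nlinarith [hy'.1, hy'.2]
    have hw0 : 0 ≤ w := Real.sqrt_nonneg _
    have hw2 : w ^ 2 = 1 - y 0 ^ 2 := Real.sq_sqrt hu
    have h1w : (0:ℝ) < 1 + w := by linarith
    refine ⟨fun _ => y 0 / (1 + w), ?_, ?_⟩
    · show y 0 / (1 + w) ∈ Ioo (-1:ℝ) 1
      constructor
      · rw [lt_div_iff₀ h1w]
        linarith [hy'.1]
      · rw [div_lt_one h1w]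
        linarith [hy'.2]
    · funext i
      obtain rfl : i = 0 := Fin.fin_one_eq_zero i
      have hy2 : y 0 ^ 2 = (1 + w) * (1 - w) := by linear_combination hw2
      have hden : 1 + (y 0 / (1 + w)) ^ 2 = 2 / (1 + w) := by
        rw [div_pow, hy2, pow_two, mul_div_mul_left _ _ h1w.ne', one_add_div h1w.ne']
        ring
      show 2 * (y 0 / (1 + w)) / (1 + (y 0 / (1 + w)) ^ 2) = y 0
      rw [hden, div_div_eq_mul_div, div_eq_iff (two_ne_zero : (2:ℝ) ≠ 0), mul_assoc,
        div_mul_cancel₀ _ h1w.ne']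
      ring

/-- `Φ` is a `ℚ`-semialgebraic map on any `ℚ`-semialgebraic set (a quotient of polynomials with a
non-vanishing denominator). [folklore] -/
theorem piArc_isSemialgebraicMapOn {s : Set (Fin 1 → ℝ)} (hs : IsSemialgebraic ℚ s) :
    IsSemialgebraicMapOn ℚ s (fun y : Fin 1 → ℝ => (fun _ : Fin 1 => 2 * y 0 / (1 + y 0 ^ 2))) := by
  refine IsSemialgebraicMapOn.of_forall hs fun _ => ?_
  refine (isSemialgebraicFunOn_aeval_div_aeval hs (2 * X 0) (1 + X 0 ^ 2) fun x _ => ?_).congr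
    fun x _ => ?_
  · simp only [map_add, map_one, map_pow, MvPolynomial.aeval_X]
    positivity
  · simp

/-- `Φ` is differentiable, with derivative `Φ'(t) · id`, `Φ'(t) = 2(1−t²)/(1+t²)²`, of determinant
`Φ'(t)`. [folklore] -/
theorem piArc_hasFDerivAt (x : Fin 1 → ℝ) :
    ∃ L : (Fin 1 → ℝ) →L[ℝ] (Fin 1 → ℝ),
      HasFDerivAt (fun y : Fin 1 → ℝ => (fun _ : Fin 1 => 2 * y 0 / (1 + y 0 ^ 2))) L x ∧
      L.det = 2 * (1 - x 0 ^ 2) / (1 + x 0 ^ 2) ^ 2 := by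
  set c : ℝ := 2 * (1 - x 0 ^ 2) / (1 + x 0 ^ 2) ^ 2 with hc
  refine ⟨c • ContinuousLinearMap.id ℝ (Fin 1 → ℝ), ?_, ?_⟩
  · have hg : HasDerivAt (fun t : ℝ => 2 * t / (1 + t ^ 2)) c (x 0) := by
      have hnum : HasDerivAt (fun t : ℝ => 2 * t) 2 (x 0) := by
        simpa using (hasDerivAt_id (x 0)).const_mul 2
      have hden : HasDerivAt (fun t : ℝ => 1 + t ^ 2) (2 * x 0) (x 0) := by
        simpa using (hasDerivAt_pow 2 (x 0)).const_add 1
      have hne : (1 + x 0 ^ 2) ≠ 0 := by positivity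
      refine (hnum.div hden hne).congr_deriv ?_
      rw [hc]
      ring
    have h0 : HasFDerivAt (fun y : Fin 1 → ℝ => y 0)
        (ContinuousLinearMap.proj (R := ℝ) (φ := fun _ : Fin 1 => ℝ) 0) x :=
      hasFDerivAt_apply 0 x
    have h1 := hg.comp_hasFDerivAt x h0
    have h2 : HasFDerivAt (fun y : Fin 1 → ℝ => 2 * y 0 / (1 + y 0 ^ 2))
        (c • ContinuousLinearMap.proj (R := ℝ) (φ := fun _ : Fin 1 => ℝ) 0) x := h1
    rw [hasFDerivAt_pi']
    intro i
    refine h2.congr_fderiv (ContinuousLinearMap.ext fun v => ?_)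
    obtain rfl : i = 0 := Fin.fin_one_eq_zero i
    simp [smul_eq_mul]
  · change LinearMap.det ((c • ContinuousLinearMap.id ℝ (Fin 1 → ℝ) : (Fin 1 → ℝ) →L[ℝ] (Fin 1 → ℝ)) :
      (Fin 1 → ℝ) →ₗ[ℝ] (Fin 1 → ℝ)) = c
    simp only [ContinuousLinearMap.toLinearMap_smul, ContinuousLinearMap.coe_id, LinearMap.det_smul,
      LinearMap.det_id, Module.finrank_fin_fun, pow_one, mul_one]

/-- The pull-back identity of the substitution, Jacobian included:
`(1/√(1 − Φ(t)²)) · Φ'(t) = 2/(1+t²)` on `(-1,1)` (`√(1−Φ(t)²) = (1−t²)/(1+t²)`). [folklore] -/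
theorem piArc_pullback {t : ℝ} (ht : t ∈ Ioo (-1:ℝ) 1) :
    (√(1 - (2 * t / (1 + t ^ 2)) ^ 2))⁻¹ * (2 * (1 - t ^ 2) / (1 + t ^ 2) ^ 2) =
      2 / (1 + t ^ 2) := by
  have hpos : (0:ℝ) < 1 + t ^ 2 := by positivity
  have hmt : (0:ℝ) < 1 - t ^ 2 := by nlinarith [ht.1, ht.2]
  have hsq : 1 - (2 * t / (1 + t ^ 2)) ^ 2 = ((1 - t ^ 2) / (1 + t ^ 2)) ^ 2 := by
    field_simp
    ring
  rw [hsq, Real.sqrt_sq (div_pos hmt hpos).le]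
  field_simp

/-! ## The stub -/

/-- **Registered stub `stub_piAsArctan`** (line `dirichlet-companion-to-pi` of crux
stmt-KontsevichZagierPeriods-13633): `π = ∫_{-1}^{1} 2 dt/(1+t²)` inside the calculus,
`[(-1,1), 2/(1+t²)] ∼ [{x²+y² ≤ 1}, 1]`: one rule-(2) move `x = 2t/(1+t²)` onto
`[(-1,1), 1/√(1−x²)]`, then Kontsevich–Zagier's §1.1 chain `1/√(1−x²) ↔ 2√(1−x²) ↔ disc`; any
representations `T`, `P` with the displayed domains and integrands are `KZ.Equivalent`.
[cite: KontsevichZagier2001, §1.1] -/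
theorem stub_piAsArctan :
    ∀ (T : Literature.NumberTheory.Transcendental.KZ.IntegralRep 1)
      (P : Literature.NumberTheory.Transcendental.KZ.IntegralRep 2),
    T.domain = {x | x 0 ∈ Set.Ioo (-1:ℝ) 1} →
    Set.EqOn T.integrand (fun x => 2 / (1 + (x 0) ^ 2)) T.domain →
    P.domain = {z | z 0 ^ 2 + z 1 ^ 2 ≤ 1} → Set.EqOn P.integrand (fun _ => 1) P.domain →
    Literature.NumberTheory.Transcendental.KZ.Equivalent T P := by
  intro T P hTd hTi hPd hPi
  choose Φ' hD hdet using piArc_hasFDerivAt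
  -- the substitution maps `T.domain = (-1,1)` onto `invSqrtRep.domain = (-1,1)`
  have himage : invSqrtRep.domain =
      (fun y : Fin 1 → ℝ => (fun _ : Fin 1 => 2 * y 0 / (1 + y 0 ^ 2))) '' T.domain := by
    rw [hTd, piArc_image]
    rfl
  -- move (2): `[T] − [invSqrtRep] ∈ changeOfVariablesRel`
  have hT : Equivalent T invSqrtRep :=
    changeOfVariablesRel_subset_relations
      ⟨1, T, invSqrtRep, fun y : Fin 1 → ℝ => (fun _ : Fin 1 => 2 * y 0 / (1 + y 0 ^ 2)), Φ',
        piArc_isSemialgebraicMapOn T.isSemialgebraic_domain, fun x _ => (hD x).hasFDerivWithinAt,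
        by rw [hTd]; exact piArc_injOn, himage, fun x hx => by
          have ht : x 0 ∈ Ioo (-1:ℝ) 1 := by rw [hTd] at hx; exact hx
          have hΦx : (fun _ : Fin 1 => 2 * x 0 / (1 + x 0 ^ 2)) ∈ symIoo := piArc_mapsTo ht
          have hc : (0:ℝ) < 2 * (1 - x 0 ^ 2) / (1 + x 0 ^ 2) ^ 2 := by
            have : (0:ℝ) < 1 - x 0 ^ 2 := by nlinarith [ht.1, ht.2]
            positivity
          rw [hTi hx, invSqrtRep_integrand_eq hΦx, hdet x, abs_of_pos hc]
          exact (piArc_pullback ht).symm, rfl⟩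
  -- `[P] − [piRep]` is a relation: same domain, same integrand on it
  have hP : Equivalent P piRep :=
    of_sub_of_mem_relations_of_eqOn (by rw [hPd]; rfl) fun z hz => (hPi hz).trans rfl
  exact ((hT.trans equivalent_invSqrtRep_twoSqrtRep).trans equivalent_twoSqrtRep_piRep).trans hP.symm

end Summit.KontsevichZagierPeriods.KontsevichZagierPeriods.BetaCancellationLine
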